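import Mathlib
import Summits.ValiantsHypothesis.ValiantsHypothesis.Theorems.LacunarySymmetroidMatrixDescartesCensusDefs
import Summits.ValiantsHypothesis.ValiantsHypothesis.Theorems.LacunarySymmetroidMatrixDescartesStubDescartesCeiling
import Summits.ValiantsHypothesis.ValiantsHypothesis.Theorems.KPlusLogSqLawWeakLiftingTowerGraftLawBoundedLetters

/-!
# Tower graft line — EVERY FIXED-LETTER TRUNCATION OF THE GRAFT-LAW STUBS S4 (GL-Id), S4b (GL-corner), S5ᴸ (GLᴸ) IS A DESCARTES THEOREM

Calibration file for the line `Cruxes/WeakLifting/Lines/tower_graft.lean` (crux `WeakLifting` = stmt-ValiantsHypothesis-19561), objects of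
the registered stubs S4 `stub_graftLawId : TowerGraftLawId`, S4b `stub_graftLawCorner : TowerGraftLawCorner` and S5ᴸ
`stub_graftLawPolylog : TowerGraftLawPolylog`.  NO stub is claimed and none of S4 / S4b / S5ᴸ is proved: this file proves the three bodies
with the quantifiers `∃ C ∀ K` (resp. `∃ E A ∀ K`) WEAKENED to `∀ K₀ ∃ C ∀ K ≤ K₀` — PARTIAL-RANGE theorems, stated honestly as such.  It is
the by-name companion of `…TowerGraftLawBoundedLetters.lean` (S5, `towerGraftLaw_bounded_letters`, C = K₀(K₀+2)) and of
`…TowerGraftSizeDoublingBoundedLetters.lean` (S4d / S4f): with these, EVERY registered stub of the line has its fixed-letter truncation in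
the kernel, on its own binder shape — the research content of each is the UNIFORMITY IN `K`.

* `pencil_snoc` — `∑_{l<K+1} X^{(d ⊔ D) l}·(S ⊔ T) l = (∑_{l<K} X^{d l}·S l) + X^D·T` (bookkeeping for `Fin.snoc`).
* `snoc_isSymm` — the grafted letter family is symmetric when `S` and `T` are.
* ★ `towerGraftLawId_bounded_letters (K₀)` — the body of `TowerGraftLawId` with `K ≤ K₀` inserted, `C = K₀(K₀+2)`: the identity graft
  `det(G + X^D·1)` (from S5-bounded with `T = 1`).
* ★ `towerGraftLawCorner_bounded_letters (K₀)` — the body of `TowerGraftLawCorner` with `K ≤ K₀` inserted, same `C`: the corner graft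
  `det(G + X^D·eᵢeᵢᵀ)` (from S5-bounded with `T = eᵢeᵢᵀ`).
* `succ_mul_self_le_two_pow_succ`, `choose_succ_letters_le_two_pow_polylog` — arithmetic: `(K+1)K ≤ 2^{K+1}`; `K ≤ K₀ ⇒ C(m+K, m) ≤ 2^{(log₂ m + 2)^{K₀+2}}`.
* ★ `towerGraftLawPolylog_bounded_letters (K₀)` — the body of `TowerGraftLawPolylog` with `K ≤ K₀` inserted, `(E, A) = (0, K₀+2)`: here the
  additive term `2^{(log₂ m + 2)^A}` alone pays at EVERY size (`C(m+K, m) ≤ (m+K)^{K} ≤ 2^{(log₂ m + 1 + K₀)K₀} ≤ 2^{(log₂ m + 2)^{K₀+2}}`),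
  so neither the tower nor the far-exponent nor the class-budget hypothesis is used.

HONEST FRAMING: Descartes bookkeeping (`stub_descartesCeiling` through `posRootLawOn_snoc_descartes` / `towerGraftLaw_bounded_letters`);
S4/S4b/S4d/S4f/S5/S5ᴸ, TowerB, `WeakLifting`, Conjecture B, `MatrixDescartes` (18050) untouched; VP ≠ VNP NOT proved.  Def-free.
Seat: prover leafhand-val-kpluslogsqlaw-1 g2, `--supports stmt-ValiantsHypothesis-19561`.
-/

-- `Summit.ValiantsHypothesis.ValiantsHypothesis.…` repeats a component by the D-0017 layout
-- (single-conjunct summit), which the `dupNamespace` linter flags; the name is mandated.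
set_option linter.dupNamespace false

namespace Summit.ValiantsHypothesis.ValiantsHypothesis.Theorems.KPlusLogSqLaw.TowerGraft

open Polynomial Matrix
open scoped BigOperators Polynomial
open Summit.ValiantsHypothesis.ValiantsHypothesis.Theorems.LacunarySymmetroidMatrixDescartes (PosRootLawOn stub_descartesCeiling)

section GraftLawVariantsBoundedLetters

/-- **grafting bookkeeping**: the pencil on the support `Fin.snoc d D` with letters `Fin.snoc S T` is the old pencil plus `X^D·T`. [bookkeeping] -/
theorem pencil_snoc {m K : ℕ} (d : Fin K → ℕ) (D : ℕ) (S : Fin K → Matrix (Fin m) (Fin m) ℝ) (T : Matrix (Fin m) (Fin m) ℝ) :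
    (∑ l, (X : ℝ[X]) ^ (Fin.snoc d D : Fin (K + 1) → ℕ) l • ((Fin.snoc S T : Fin (K + 1) → Matrix (Fin m) (Fin m) ℝ) l).map C) =
      (∑ l, (X : ℝ[X]) ^ d l • (S l).map C) + (X : ℝ[X]) ^ D • T.map C := by
  rw [Fin.sum_univ_castSucc]
  simp only [Fin.snoc_castSucc, Fin.snoc_last]

/-- the grafted letter family `Fin.snoc S T` is symmetric when `S` and `T` are. [bookkeeping] -/
theorem snoc_isSymm {m K : ℕ} (S : Fin K → Matrix (Fin m) (Fin m) ℝ) (T : Matrix (Fin m) (Fin m) ℝ) (hS : ∀ l, (S l).IsSymm)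
    (hT : T.IsSymm) : ∀ l, ((Fin.snoc S T : Fin (K + 1) → Matrix (Fin m) (Fin m) ℝ) l).IsSymm := by
  intro l
  induction l using Fin.lastCases with
  | last => simpa using hT
  | cast i => simpa using hS i

/-- **EVERY FIXED-LETTER TRUNCATION OF S4 (GL-Id) IS A DESCARTES THEOREM.**  For every `K₀` there is `C` (namely `K₀(K₀+2)`) such that the body
of `TowerGraftLawId` holds for all `m, B, D, d` and all `K ≤ K₀`: grafting the identity at a far exponent on a `K`-letter tower costs at most
`2^C·B + 2^{C·(log₂ m)²}`.  (S4 itself asks for ONE `C` for ALL `K` and is NOT proved here.) [this work] -/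
theorem towerGraftLawId_bounded_letters (K₀ : ℕ) :
    ∃ C : ℕ, ∀ (m K B D : ℕ) (d : Fin K → ℕ), K ≤ K₀ → (∀ l l' : Fin K, l < l' → m * d l < d l') → (∀ l, m * d l < D) →
      PosRootLawOn m K B d → ∀ (S : Fin K → Matrix (Fin m) (Fin m) ℝ), (∀ l, (S l).IsSymm) →
        ((Matrix.det ((∑ l, ((X : ℝ[X]) ^ d l) • (S l).map Polynomial.C) +
            (X : ℝ[X]) ^ D • (1 : Matrix (Fin m) (Fin m) ℝ[X]))).roots.toFinset.filter
          (fun t => 0 < t)).card ≤ 2 ^ C * B + 2 ^ (C * Nat.log 2 m ^ 2) := by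
  obtain ⟨C₀, hC⟩ := towerGraftLaw_bounded_letters K₀
  refine ⟨C₀, fun m K B D d hK hd hD hB S hS => ?_⟩
  have h := hC m K B D d hK hd hD hB (Fin.snoc S 1) (snoc_isSymm S 1 hS Matrix.isSymm_one)
  rw [pencil_snoc, Matrix.map_one (Polynomial.C : ℝ → ℝ[X]) (map_zero _) (map_one _)] at h
  exact h

/-- **EVERY FIXED-LETTER TRUNCATION OF S4b (GL-corner) IS A DESCARTES THEOREM.**  For every `K₀` there is `C` (namely `K₀(K₀+2)`) such that
the body of `TowerGraftLawCorner` holds for all `m, B, D, d, i` and all `K ≤ K₀`: adding `X^D` to ONE diagonal entry of a `K`-letter tower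
pencil costs at most `2^C·B + 2^{C·(log₂ m)²}`.  (S4b itself asks for ONE `C` for ALL `K` and is NOT proved here.) [this work] -/
theorem towerGraftLawCorner_bounded_letters (K₀ : ℕ) :
    ∃ C : ℕ, ∀ (m K B D : ℕ) (d : Fin K → ℕ), K ≤ K₀ → (∀ l l' : Fin K, l < l' → m * d l < d l') → (∀ l, m * d l < D) →
      PosRootLawOn m K B d → ∀ (S : Fin K → Matrix (Fin m) (Fin m) ℝ) (i : Fin m), (∀ l, (S l).IsSymm) →
        ((Matrix.det ((∑ l, ((X : ℝ[X]) ^ d l) • (S l).map Polynomial.C) +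
            (X : ℝ[X]) ^ D • (Matrix.vecMulVec (Pi.single i (1 : ℝ)) (Pi.single i (1 : ℝ))).map Polynomial.C)).roots.toFinset.filter
          (fun t => 0 < t)).card ≤ 2 ^ C * B + 2 ^ (C * Nat.log 2 m ^ 2) := by
  obtain ⟨C₀, hC⟩ := towerGraftLaw_bounded_letters K₀
  refine ⟨C₀, fun m K B D d hK hd hD hB S i hS => ?_⟩
  have hT : (Matrix.vecMulVec (Pi.single i (1 : ℝ)) (Pi.single i (1 : ℝ))).IsSymm := by
    unfold Matrix.IsSymm
    exact Matrix.transpose_vecMulVec _ _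
  have h := hC m K B D d hK hd hD hB (Fin.snoc S (Matrix.vecMulVec (Pi.single i (1 : ℝ)) (Pi.single i (1 : ℝ))))
    (snoc_isSymm S _ hS hT)
  rw [pencil_snoc] at h
  exact h

/-- `(K+1)·K ≤ 2^{K+1}`. [arithmetic] -/
theorem succ_mul_self_le_two_pow_succ (K : ℕ) : (K + 1) * K ≤ 2 ^ (K + 1) := by
  induction K with
  | zero => simp
  | succ K ih =>
    have hK : K + 1 ≤ 2 ^ K := Nat.lt_two_pow_self
    calc (K + 1 + 1) * (K + 1) = (K + 1) * K + 2 * (K + 1) := by ring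
      _ ≤ 2 ^ (K + 1) + 2 * 2 ^ K := Nat.add_le_add ih (Nat.mul_le_mul_left 2 hK)
      _ = 2 ^ (K + 1 + 1) := by ring

/-- the arithmetic of the polylog door in the Descartes zone: `K ≤ K₀` ⇒ `C(m+K, m) ≤ 2^{(log₂ m + 2)^{K₀+2}}` (every `m`). [this work] -/
theorem choose_succ_letters_le_two_pow_polylog {m K K₀ : ℕ} (hK : K ≤ K₀) :
    Nat.choose (m + K) m ≤ 2 ^ ((Nat.log 2 m + 2) ^ (K₀ + 2)) := by
  set L := Nat.log 2 m with hL
  have hmlt : m < 2 ^ (L + 1) := Nat.lt_pow_succ_log_self (by norm_num) m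
  have hK₀lt : K₀ < 2 ^ K₀ := Nat.lt_two_pow_self
  -- `C(m+K, m) = C(m+K, K) ≤ (m+K)^K ≤ (2^{L+1+K₀})^{K} ≤ (2^{L+1+K₀})^{K₀}`
  have h1 : Nat.choose (m + K) m = Nat.choose (m + K) K := by rw [Nat.choose_symm_add]
  have h2 : Nat.choose (m + K) K ≤ (m + K) ^ K := Nat.choose_le_pow _ _
  have hmK : m + K ≤ 2 ^ (L + 1 + K₀) := by
    have ha : m + K ≤ (m + 1) * (K₀ + 1) := by nlinarith
    have hb : (m + 1) * (K₀ + 1) ≤ 2 ^ (L + 1) * 2 ^ K₀ := Nat.mul_le_mul (by omega) (by omega)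
    rw [pow_add]
    exact ha.trans hb
  have h3 : (m + K) ^ K ≤ (2 ^ (L + 1 + K₀)) ^ K := Nat.pow_le_pow_left hmK _
  have h4 : (2 ^ (L + 1 + K₀)) ^ K ≤ (2 ^ (L + 1 + K₀)) ^ K₀ := Nat.pow_le_pow_right Nat.one_le_two_pow hK
  -- exponent bookkeeping: `(L+1+K₀)·K₀ ≤ (L+2)(K₀+1)K₀ ≤ (L+2)·2^{K₀+1} ≤ (L+2)^{K₀+2}`
  have h5 : (L + 1 + K₀) * K₀ ≤ (L + 2) ^ (K₀ + 2) := by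
    have hA : L + 1 + K₀ ≤ (L + 2) * (K₀ + 1) := by nlinarith
    have hB : (K₀ + 1) * K₀ ≤ 2 ^ (K₀ + 1) := succ_mul_self_le_two_pow_succ K₀
    have hC : 2 ^ (K₀ + 1) ≤ (L + 2) ^ (K₀ + 1) := Nat.pow_le_pow_left (by omega) _
    calc (L + 1 + K₀) * K₀ ≤ (L + 2) * (K₀ + 1) * K₀ := Nat.mul_le_mul_right _ hA
      _ = (L + 2) * ((K₀ + 1) * K₀) := by ring
      _ ≤ (L + 2) * 2 ^ (K₀ + 1) := Nat.mul_le_mul_left _ hB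
      _ ≤ (L + 2) * (L + 2) ^ (K₀ + 1) := Nat.mul_le_mul_left _ hC
      _ = (L + 2) ^ (K₀ + 2) := by ring
  calc Nat.choose (m + K) m = Nat.choose (m + K) K := h1
    _ ≤ (m + K) ^ K := h2
    _ ≤ (2 ^ (L + 1 + K₀)) ^ K := h3
    _ ≤ (2 ^ (L + 1 + K₀)) ^ K₀ := h4
    _ = 2 ^ ((L + 1 + K₀) * K₀) := (pow_mul 2 _ _).symm
    _ ≤ 2 ^ ((L + 2) ^ (K₀ + 2)) := Nat.pow_le_pow_right (by norm_num) h5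

/-- **EVERY FIXED-LETTER TRUNCATION OF S5ᴸ (GLᴸ, the polylog graft law) IS A DESCARTES THEOREM.**  For every `K₀` there are `E, A` (namely
`(0, K₀+2)`) such that the body of `TowerGraftLawPolylog` holds for all `m, B, D, d` and all `K ≤ K₀`; the additive term alone pays, so the tower,
far-exponent and class-budget hypotheses are idle.  (S5ᴸ itself asks for ONE pair `(E, A)` for ALL `K` and is NOT proved here.) [this work] -/
theorem towerGraftLawPolylog_bounded_letters (K₀ : ℕ) :
    ∃ E A : ℕ, ∀ (m K B D : ℕ) (d : Fin K → ℕ), K ≤ K₀ → (∀ l l' : Fin K, l < l' → m * d l < d l') → (∀ l, m * d l < D) →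
      PosRootLawOn m K B d →
      PosRootLawOn m (K + 1) ((Nat.log 2 m + 2) ^ E * B + 2 ^ ((Nat.log 2 m + 2) ^ A)) (Fin.snoc d D) := by
  refine ⟨0, K₀ + 2, fun m K B D d hK _ _ _ => ?_⟩
  intro S hS
  have hdesc := posRootLawOn_snoc_descartes m K D d S hS
  have h := choose_succ_letters_le_two_pow_polylog (m := m) hK
  omega

end GraftLawVariantsBoundedLetters

end Summit.ValiantsHypothesis.ValiantsHypothesis.Theorems.KPlusLogSqLaw.TowerGraft
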